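import Summits.ResolutionOfSingularities.ResolutionOfSingularities.Theorems.HomologicalConductorNoZenoRQuadraticTransformSingularFinite
import Summits.ResolutionOfSingularities.ResolutionOfSingularities.Theorems.HomologicalConductorNoZenoRMinimalResolutionLocalises
import Summits.ResolutionOfSingularities.ResolutionOfSingularities.Theorems.HomologicalConductorNoZenoRKernelGenerated
import Summits.ResolutionOfSingularities.ResolutionOfSingularities.Theorems.HomologicalConductorNoZenoRQuadraticTransformStages
import HarnessLib

/-!
# Crux `NoZenoR` (stmt-ResolutionOfSingularities-19943) — [U] assembled: the germs of the MINIMAL desingularization of a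
# rational `S` over the closed points of the quadratic transform `Bl_𝔪 Spec S` are MINIMAL desingularizations

Route `ResolutionOfSingularities/HomologicalConductor` (cell decomp-res, hand leafhand-res-homologicalconduct-24 g0).
OURS: AI-written assembly over tree theorems, weaker than expert review; nothing here is a statement of the manuscript
under review (Hironaka 2017).  SUPPORT level, counted 0.  Def-free, fact-free (Lipman (4.1), (8.1), (1.2) are tree
theorems).

* **`isMinimalResolution_germ_of_isMinimalResolution`** — `S` a two-dimensional Noetherian local normal domain with a
  rational singularity, NOT regular; `π : X → Spec S` the minimal desingularization; `σ : X → V := Bl_𝔪 Spec S` a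
  desingularization with `σ ≫ (V → Spec S) = π`.  Then for every CLOSED point `v ∈ V` the base change
  `X ×_V Spec 𝒪_{V,v} → Spec 𝒪_{V,v}` is a MINIMAL desingularization.  Assembly of: `σ` is minimal for `V`
  (`isMinimalResolution_of_fac_isBlowup`); `V` has finitely many non-regular points, all closed and over `𝔪`
  (`finite_setOf_not_isRegularLocalRing_stalk`); their local rings are two-dimensional normal RATIONAL
  (`Lipman1969_8_1_holds`, `hasRationalSingularity_stalk_of_stage`) hence have minimal desingularizations that are blow-ups
  (`QuadraticTransform.exists_isMinimalResolution_isBlowup`); and minimality localises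
  (`GlobalResolution.IsMinimalResolution.pullback_snd_fromSpecStalk`).

With [G] (`isClosed_singleton_apply_of_firstKind`) this leaves, for the hypothesis `hstep` of `…MinimalNoFirstKindOfStep`,
only the germ dictionary [B] (lift of the first-kind curve with its `h⁰`-numbers and `excCurvePoints` of the germ; memo
MEMO-19943-hand24g0-M0-ROAD.md).  No crux or summit statement is proved here.
-/

noncomputable section

-- single-problem summit: the doubled namespace component `ResolutionOfSingularities` is forced
set_option linter.dupNamespace false

open CategoryTheory CategoryTheory.Limits AlgebraicGeometry TopologicalSpace IsLocalRing
open Literature.AlgebraicGeometry Literature.AlgebraicGeometry.Resolution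

namespace Summit.ResolutionOfSingularities.ResolutionOfSingularities.Theorems.NoZeno.FirstKind

variable {S : Type} [CommRing S] [IsNoetherianRing S] [IsLocalRing S] [IsDomain S] [IsIntegrallyClosed S]
  {X : Scheme.{0}} (π : X ⟶ Spec (.of S))

/-- **[U] — the germs of the minimal desingularization over the quadratic transform are minimal.**  For `S` rational
(two-dimensional normal local), `π : X → Spec S` MINIMAL, `σ : X → Bl_𝔪 Spec S` a desingularization with `σ ≫ (Bl_𝔪 → Spec S) = π`, and a
closed point `v` of `Bl_𝔪 Spec S`: `IsMinimalResolution (pullback.snd σ ((Bl_𝔪 Spec S).fromSpecStalk v))`.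
[cite: Lipman1969, Theorem (4.1) (p. 204); Proposition (8.1) (p. 212); Proposition (1.2) (p. 199)] -/
theorem isMinimalResolution_germ_of_isMinimalResolution (hdim : ringKrullDim S = 2)
    (hrat : HasRationalSingularity S) (hπ : IsMinimalResolution π)
    (σ : X ⟶ affineBlowup (maximalIdeal S)) (hσ : σ ≫ affineBlowup.π (maximalIdeal S) = π)
    (hσres : IsResolution σ) (v : affineBlowup (maximalIdeal S))
    (hvc : IsClosed ({v} : Set (affineBlowup (maximalIdeal S)))) :
    IsMinimalResolution (pullback.snd σ ((affineBlowup (maximalIdeal S)).fromSpecStalk v)) := by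
  have hb : IsBlowup (affineBlowup.π (maximalIdeal S)) (affineBlowup.idealSheaf (maximalIdeal S)) :=
    affineBlowup.isBlowup _
  have hI0 := affineBlowupIdealSheaf_maximalIdeal_ne_bot (S := S) hdim
  haveI : IsIntegral (affineBlowup (maximalIdeal S)) := hb.isIntegral hI0
  haveI : IsLocallyNoetherian (affineBlowup (maximalIdeal S)) :=
    LocallyOfFiniteType.isLocallyNoetherian (affineBlowup.π (maximalIdeal S))
  haveI : CompactSpace (affineBlowup (maximalIdeal S)) :=
    QuasiCompact.compactSpace_of_compactSpace (affineBlowup.π (maximalIdeal S))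
  haveI : IsNoetherian (affineBlowup (maximalIdeal S)) := {}
  have hbir : IsBirational (affineBlowup.π (maximalIdeal S)) := hb.isBirational' hI0
  -- `σ` is minimal for the quadratic transform
  have hσmin : IsMinimalResolution σ := isMinimalResolution_of_fac_isBlowup π hπ hb hI0 σ hσ hσres
  -- the finite set of non-regular points
  set Z : Set (affineBlowup (maximalIdeal S)) :=
    {w | ¬ IsRegularLocalRing ((affineBlowup (maximalIdeal S)).presheaf.stalk w)} with hZ
  have hZf : Z.Finite := finite_setOf_not_isRegularLocalRing_stalk π hdim hrat hπ.1 σ hσ hσres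
  have hN : ∀ w : affineBlowup (maximalIdeal S), IsIntegrallyClosed ((affineBlowup (maximalIdeal S)).presheaf.stalk w) :=
    fun w => QuadraticTransform.Lipman1969_8_1_holds S hdim hrat w
  have hdimV : topologicalKrullDim (affineBlowup (maximalIdeal S)) ≤ 2 := by
    have h2 : topologicalKrullDim (PrimeSpectrum S) ≤ (2 : ℕ) := by
      rw [PrimeSpectrum.topologicalKrullDim_eq_ringKrullDim]
      exact_mod_cast hdim.le
    exact_mod_cast hb.topologicalKrullDim_le h2
  have hZc : ∀ w ∈ Z, IsClosed ({w} : Set (affineBlowup (maximalIdeal S))) := fun w hw =>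
    isClosed_singleton_of_not_mem_regularLocus hN hdimV (fun h => hw ((Scheme.mem_regularLocus w).mp h))
  have hgen : genericPoint (affineBlowup (maximalIdeal S)) ∉ Z := by
    intro h
    apply h
    exact inferInstanceAs (IsRegularLocalRing (affineBlowup (maximalIdeal S)).functionField)
  have hreg : ∀ w : affineBlowup (maximalIdeal S), w ∉ Z → w ∈ Scheme.regularLocus (affineBlowup (maximalIdeal S)) :=
    fun w hw => (Scheme.mem_regularLocus w).mpr (not_not.mp hw)
  -- the local minimal desingularizations at the non-regular points (rational by (1.2), normal by (8.1))
  have hloc : ∀ w ∈ Z, ∃ (Xw : Scheme.{0}) (ρ : Xw ⟶ Spec ((affineBlowup (maximalIdeal S)).presheaf.stalk w))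
      (I : (Spec ((affineBlowup (maximalIdeal S)).presheaf.stalk w)).IdealSheafData),
      IsMinimalResolution ρ ∧ IsBlowup ρ I ∧
        (I.support : Set (Spec ((affineBlowup (maximalIdeal S)).presheaf.stalk w))) ⊆
          {closedPoint ((affineBlowup (maximalIdeal S)).presheaf.stalk w)} := by
    intro w hw
    haveI : IsIntegrallyClosed ((affineBlowup (maximalIdeal S)).presheaf.stalk w) := hN w
    haveI : IsNoetherianRing ((affineBlowup (maximalIdeal S)).presheaf.stalk w) := inferInstance
    have hdimw : ringKrullDim ((affineBlowup (maximalIdeal S)).presheaf.stalk w) = 2 :=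
      QuadraticTransform.ringKrullDim_stalk_eq_two_of_not_isRegularLocalRing hdim (affineBlowup.π (maximalIdeal S))
        hbir (hN w) hw
    have hratw : HasRationalSingularity ((affineBlowup (maximalIdeal S)).presheaf.stalk w) :=
      QuadraticTransform.hasRationalSingularity_stalk_of_stage (affineBlowup.π (maximalIdeal S)) hdim hrat hbir w
        (hN w) hdimw
    exact QuadraticTransform.exists_isMinimalResolution_isBlowup
      (S := (affineBlowup (maximalIdeal S)).presheaf.stalk w) hdimw hratw
  exact GlobalResolution.IsMinimalResolution.pullback_snd_fromSpecStalk Z hZf hZc hgen hreg hloc hσmin v hvc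

end Summit.ResolutionOfSingularities.ResolutionOfSingularities.Theorems.NoZeno.FirstKind

end
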